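import Mathlib
import Summits.Ventures.PercRepro2.BundleRelay

/-! # The series step `X ∧ B_K` of (UH*), `K ≥ 3`: the theorem of MINE-B.md §25.2
(seat mine-b, cell pub-perc-repro2)

Let `(X, r, b)` be a finite labelled preorder with an (UH*) assignment `f`, a red-up map `θ`
(an injection of `{r ≥ 1, b ≥ 2}` into `{r ≥ 2}`, below, blue drop `≤ 1`) and the level-1 datum
**(L1)**: an injective map `g` on the blue-1 targets of the blue-1 sources (`InD1`), `g x ≤ x`,
`r (g x) ≥ 1`, `g x` neither a slot-`0` image of `f` nor in the image of `θ`.  Then the series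
product of `X` with the bundle `B_K` of `K ≥ 3` free edges satisfies (UH*) (`universal_ser_bundle`).

The assignment is the one of `universal_ser_of_maps_pi` with the chain-shift relay of the bundle:
the sources `(x, z)` with `r x = 0` go to `(f (x, i), chainShift z)`, except that a **bad** source
(`b x ≥ 2` with a blue-1 slot-`0` target) sends its slot `0` at `z = {K−1}` to `(f (x, 1), ∅)`
(`bundlePi`); the sources `(x, univ)` with `r x ≥ 1`, `b x ≥ 2` go to `(θ x, univ ∖ {i})`; and the
residual sources `(x, univ)` with `r x ≥ 1`, `b x = 1` go to `(x, univ ∖ {2})` if `r x ≥ 2`, to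
`(x, {0})` if `x` is not a slot-`0` image, to `(x, ∅)` if `x` is the slot-`0` image of a bad source,
and to `(g x, {1})` or `(g x, univ ∖ {0})` (by the red label of `g x`) if `x ∈ InD1`
(`bundlePsi`).  The avoidance conditions are discharged by the decoding facts of BundleRelay.lean:
`chainShift z = ∅` only for `z = {K−1}` (a blue-1 set, slot `0` only, re-routed when the source is
bad), `chainShift z = {c}` only for `z = {c}` when `c` is not the last element, and a one-red
second coordinate has `K − 1 ≥ 2` elements. -/

namespace Summit.Ventures.PercRepro2.UHClosure

open Finset
open Summit.Ventures.PercRepro2.V2Closure (serR serB)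

variable {X : Type*} [Preorder X] [Fintype X] {K : ℕ}

/-! ### More decoding facts for the chain shift -/

/-- a set whose chain shift is empty is a singleton -/
lemma card_eq_one_of_chainShift_eq_empty {z : Finset (Fin K)} (hz : z.Nonempty)
    (h : chainShift z = ∅) : z.card = 1 := by
  obtain ⟨h1, _⟩ := eq_last_of_chainShift_eq_empty hz h
  rw [h1, card_singleton]

/-- a singleton `{c}` with `c` not the last element is not a suffix -/
lemma not_isSuf_singleton (c : Fin K) (hc : c.val + 1 < K) : ¬ IsSuf ({c} : Finset (Fin K)) := by
  intro hs
  have := hs c (mem_singleton_self c) ⟨c.val + 1, hc⟩ (Fin.le_iff_val_le_val.2 (Nat.le_succ _))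
  rw [mem_singleton] at this
  have := congrArg Fin.val this
  simp at this

/-- a set whose chain shift is `{c}`, `c` not the last element, is `{c}` -/
lemma eq_singleton_of_chainShift_eq_singleton {z : Finset (Fin K)} (hz : z.Nonempty) (c : Fin K)
    (hc : c.val + 1 < K) (h : chainShift z = {c}) : z = {c} :=
  chainShift_eq_of_not_suf hz (not_isSuf_singleton c hc) h

omit [Preorder X] in
/-- the bundle assignment of a `Y`-slot of the product is `univ` minus the slot index -/
lemma bkAssign_serSlotY (r b : X → ℕ) (q : SlotL (USrc (serR r (rB (K := K))) (serB b bB)) (serB b bB))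
    (hz : rB q.1.1.1.2 = 0) :
    bkAssign (serSlotY r b rB bB q hz) = univ.erase ⟨q.1.2.val, (bkIdx (serSlotY r b rB bB q hz)).2⟩ :=
  rfl

/-- the second coordinate of a source of the product with `rB z = 0` is `univ` -/
lemma eq_univ_of_rB_eq_zero {z : Finset (Fin K)} (h : rB z = 0) : z = univ := by
  apply eq_univ_of_card
  unfold rB at h
  have := card_le_univ z
  simp only [Fintype.card_fin] at this ⊢
  omega

/-! ### The data of the instance -/

section instanceData

variable (r b : X → ℕ) (f : SlotL (USrc r b) b → X) (θ g : X → X)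

/-- a **bad** source: blue `≥ 2` with a blue-1 slot-`0` target -/
def Bad (x : X) : Prop :=
  2 ≤ b x ∧ ∃ q₀ : SlotL (USrc r b) b, q₀.1.1.1 = x ∧ q₀.1.2.val = 0 ∧ b (f q₀) = 1

/-- the domain of (L1): the blue-1 targets of the blue-1 sources -/
def InD1 (x : X) : Prop :=
  r x = 1 ∧ b x = 1 ∧ ∃ q : SlotL (USrc r b) b, q.1.2.val = 0 ∧ b q.1.1.1 = 1 ∧ f q = x

open Classical in
/-- the slot re-labelling: the slot `0` of a bad source at `z = {K−1}` (the only set with empty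
chain shift) is sent to slot `1`; every other slot keeps its index -/
noncomputable def bundlePi (q : SlotL (USrc (serR r (rB (K := K))) (serB b bB)) (serB b bB)) : ℕ :=
  if r q.1.1.1.1 = 0 ∧ chainShift q.1.1.1.2 = ∅ ∧ Bad r b f q.1.1.1.1 then 1 else q.1.2.val

open Classical in
/-- the residual assignment of the sources `(x, univ)` with `r x ≥ 1`, `b x = 1` -/
noncomputable def bundlePsi (hK : 3 ≤ K) (p : X × Finset (Fin K)) : X × Finset (Fin K) :=
  if 2 ≤ r p.1 then (p.1, univ.erase ⟨2, by omega⟩)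
  else if ∃ q : SlotL (USrc r b) b, q.1.2.val = 0 ∧ f q = p.1 then
    if ∃ q : SlotL (USrc r b) b, q.1.2.val = 0 ∧ 2 ≤ b q.1.1.1 ∧ f q = p.1 then (p.1, ∅)
    else if r (g p.1) = 1 then (g p.1, {⟨1, by omega⟩})
    else (g p.1, univ.erase ⟨0, by omega⟩)
  else (p.1, {⟨0, by omega⟩})

omit [Preorder X] in
/-- the residual sources that reach the (L1) datum are in its domain -/
lemma inD1_of {x : X} (h : ∃ q : SlotL (USrc r b) b, q.1.2.val = 0 ∧ f q = x)
    (h' : ¬ ∃ q : SlotL (USrc r b) b, q.1.2.val = 0 ∧ 2 ≤ b q.1.1.1 ∧ f q = x)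
    (hr2 : ¬ 2 ≤ r x) (hr : 1 ≤ r x) (hb : b x = 1) : InD1 r b f x := by
  refine ⟨by omega, hb, ?_⟩
  obtain ⟨q, hq0, hqx⟩ := h
  refine ⟨q, hq0, ?_, hqx⟩
  have h1 := q.1.1.2.1.2
  by_contra hne
  exact h' ⟨q, hq0, by omega, hqx⟩

end instanceData

/-- **THEOREM (MINE-B.md §25.2): (UH*) on `X ∧ B_K` for every `K ≥ 3`, from (UH*)(X), the red-up
map `θ` and the level-1 datum (L1).** -/
theorem universal_ser_bundle (hK : 3 ≤ K) (r b : X → ℕ)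
    (f : SlotL (USrc r b) b → X) (hf : Function.Injective f)
    (hfs : ∀ p, f p ≤ p.1.1.1 ∧ r (f p) = 1 ∧ b p.1.1.1 ≤ b (f p) + 1)
    (θ : X → X) (hθ : ∀ x x', 1 ≤ r x → 2 ≤ b x → 1 ≤ r x' → 2 ≤ b x' → θ x = θ x' → x = x')
    (hθs : ∀ x, 1 ≤ r x → 2 ≤ b x → θ x ≤ x ∧ 2 ≤ r (θ x) ∧ b x ≤ b (θ x) + 1)
    (g : X → X)
    (hg1 : ∀ x, InD1 r b f x → g x ≤ x ∧ 1 ≤ r (g x))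
    (hg2 : ∀ x, InD1 r b f x → ∀ q : SlotL (USrc r b) b, q.1.2.val = 0 → f q ≠ g x)
    (hg3 : ∀ x, InD1 r b f x → ∀ x', 1 ≤ r x' → 2 ≤ b x' → θ x' ≠ g x)
    (hg4 : ∀ x x', InD1 r b f x → InD1 r b f x' → g x = g x' → x = x') :
    Universal (serR r (rB (K := K))) (serB b bB) := by
  classical
  have h0 : 0 < K := by omega
  -- the hypotheses on π
  have hπ : ∀ q : SlotL (USrc (serR r (rB (K := K))) (serB b bB)) (serB b bB),
      r q.1.1.1.1 = 0 → bundlePi r b f q < b q.1.1.1.1 := by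
    intro q hx
    unfold bundlePi
    split_ifs with h
    · exact h.2.2.1
    · have := q.2; simp only [serB] at this; omega
  have hπinj : ∀ q q' : SlotL (USrc (serR r (rB (K := K))) (serB b bB)) (serB b bB),
      r q.1.1.1.1 = 0 → q.1.1.1 = q'.1.1.1 → bundlePi r b f q = bundlePi r b f q' → q = q' := by
    intro q q' hx hsrc hpi
    apply ser_slot_ext q q' hsrc
    have hi := q.2; have hi' := q'.2
    simp only [serB] at hi hi'
    have hblue := ser_src_blue r b rB bB q.1.1.2.1
    have hblue' := ser_src_blue r b rB bB q'.1.1.2.1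
    unfold bundlePi at hpi
    rw [hsrc] at hpi
    split_ifs at hpi with h
    · -- both re-routed: the set `{K−1}` has one slot
      have hc := card_eq_one_of_chainShift_eq_empty (card_pos.1 hblue'.2) h.2.1
      have hc2 : (q.1.1.1.2).card = 1 := by rw [hsrc]; exact hc
      try simp only [bB] at hi hi'
      omega
    · exact hpi
  -- the residual hypotheses
  refine universal_ser_of_maps_pi r b rB bB f hf hfs bkAssign bkAssign_injective bkAssign_spec
    chainShift chainShift_relay_inj chainShift_relay_spec θ hθ hθs (bundlePi r b f) hπ hπinj
    (bundlePsi r b f g hK) ?_ ?_ ?_ ?_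
  · -- injectivity of ψ
    intro p p' hr hb hz hr' hb' hz' heq
    have hu := eq_univ_of_rB_eq_zero hz
    have hu' := eq_univ_of_rB_eq_zero hz'
    have c2 : (univ.erase (⟨2, by omega⟩ : Fin K)).card = K - 1 := by
      rw [card_erase_of_mem (mem_univ _)]; simp
    have c0 : (univ.erase (⟨0, by omega⟩ : Fin K)).card = K - 1 := by
      rw [card_erase_of_mem (mem_univ _)]; simp
    have e20 : univ.erase (⟨2, by omega⟩ : Fin K) ≠ univ.erase ⟨0, by omega⟩ := by
      intro h
      have : (⟨0, by omega⟩ : Fin K) ∈ univ.erase (⟨2, by omega⟩ : Fin K) := by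
        rw [mem_erase]; refine ⟨?_, mem_univ _⟩
        intro h'; have := congrArg Fin.val h'; simp at this
      rw [h] at this; simp at this
    have e01 : ({⟨0, by omega⟩} : Finset (Fin K)) ≠ {⟨1, by omega⟩} := by
      intro h
      have := congrArg Fin.val (singleton_injective h); simp at this
    have hpp : p.1 = p'.1 := by
      unfold bundlePsi at heq
      split_ifs at heq <;>
        first
        | exact (Prod.mk.inj heq).1
        | exact hg4 _ _ (by apply inD1_of r b f <;> assumption) (by apply inD1_of r b f <;> assumption)
            (Prod.mk.inj heq).1
        | (exfalso
           have hs := (Prod.mk.inj heq).2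
           first
           | exact e20 hs
           | exact e20 hs.symm
           | exact e01 hs
           | exact e01 hs.symm
           | (have := congrArg Finset.card hs; simp [c2, c0] at this <;> omega))
    exact Prod.ext hpp (hu.trans hu'.symm)
  · -- the targets of ψ
    intro p hr hb hz _
    have hu := eq_univ_of_rB_eq_zero hz
    have r2 : rB (univ.erase (⟨2, by omega⟩ : Fin K)) = 1 := by
      unfold rB; rw [card_erase_of_mem (mem_univ _)]; simp; omega
    have r0 : rB (univ.erase (⟨0, by omega⟩ : Fin K)) = 1 := by
      unfold rB; rw [card_erase_of_mem (mem_univ _)]; simp; omega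
    have rE : rB (∅ : Finset (Fin K)) = K := by unfold rB; simp
    have rs0 : rB ({⟨0, by omega⟩} : Finset (Fin K)) = K - 1 := by unfold rB; simp
    have rs1 : rB ({⟨1, by omega⟩} : Finset (Fin K)) = K - 1 := by unfold rB; simp
    unfold bundlePsi
    split_ifs with h1 h2 h3 h4
    · refine ⟨Prod.mk_le_mk.2 ⟨le_rfl, by rw [hu]; exact subset_univ _⟩, ?_⟩
      simp only [serR]; rw [r2]; omega
    · refine ⟨Prod.mk_le_mk.2 ⟨le_rfl, by rw [hu]; exact subset_univ _⟩, ?_⟩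
      simp only [serR]; rw [rE]; omega
    · have hd := inD1_of r b f h2 h3 h1 hr hb
      refine ⟨Prod.mk_le_mk.2 ⟨(hg1 _ hd).1, by rw [hu]; exact subset_univ _⟩, ?_⟩
      simp only [serR]; rw [rs1, h4]; omega
    · have hd := inD1_of r b f h2 h3 h1 hr hb
      have := (hg1 _ hd).2
      refine ⟨Prod.mk_le_mk.2 ⟨(hg1 _ hd).1, by rw [hu]; exact subset_univ _⟩, ?_⟩
      simp only [serR]; rw [r0]; omega
    · refine ⟨Prod.mk_le_mk.2 ⟨le_rfl, by rw [hu]; exact subset_univ _⟩, ?_⟩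
      simp only [serR]; rw [rs0]; omega
  · -- ψ avoids the first family
    intro p hr hb hz _ q hx heq
    have hblue := ser_src_blue r b rB bB q.1.1.2.1
    have hi := q.2
    try simp only [serB, bB] at hi
    have hy := (hfs (serSlotXAt r b rB bB q hx (bundlePi r b f q) (hπ q hx))).2.1
    -- when the chain shift is a singleton `{c}`, `c` not last, the slot index is `0` and `π` is the identity
    have hsing : ∀ c : Fin K, c.val + 1 < K → chainShift q.1.1.1.2 = {c} →
        q.1.2.val = 0 ∧ bundlePi r b f q = 0 := by
      intro c hc hcs
      have hz1 := eq_singleton_of_chainShift_eq_singleton (card_pos.1 hblue.2) c hc hcs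
      have hcard : (q.1.1.1.2).card = 1 := by rw [hz1, card_singleton]
      have hidx : q.1.2.val = 0 := by omega
      refine ⟨hidx, ?_⟩
      unfold bundlePi
      rw [if_neg, hidx]
      intro h
      rw [h.2.1] at hcs
      exact singleton_ne_empty c hcs.symm
    unfold bundlePsi at heq
    split_ifs at heq with h1 h2 h3 h4
    · -- (c2): red labels
      have e1 := (Prod.mk.inj heq).1
      rw [e1] at h1; omega
    · -- (cE): the re-routed slot
      have e1 := (Prod.mk.inj heq).1
      have e2 := (Prod.mk.inj heq).2
      obtain ⟨q₀, hq0, hb0, hfq0⟩ := h3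
      have hq : serSlotXAt r b rB bB q hx (bundlePi r b f q) (hπ q hx) = q₀ := hf (by rw [← e1, hfq0])
      have hidx : bundlePi r b f q = q₀.1.2.val :=
        congrArg (fun s : SlotL (USrc r b) b => s.1.2.val) hq
      have hsrc : q.1.1.1.1 = q₀.1.1.1 := congrArg (fun s : SlotL (USrc r b) b => s.1.1.1) hq
      have hbad : Bad r b f q.1.1.1.1 :=
        ⟨by rw [hsrc]; exact hb0, q₀, hsrc.symm, hq0, by rw [hfq0]; exact hb⟩
      have hpi1 : bundlePi r b f q = 1 := by
        unfold bundlePi; rw [if_pos ⟨hx, e2.symm, hbad⟩]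
      omega
    · -- (cD1): `g x` is not a slot-0 image
      have e1 := (Prod.mk.inj heq).1
      have e2 := (Prod.mk.inj heq).2
      have hd := inD1_of r b f h2 h3 h1 hr hb
      obtain ⟨_, hpi⟩ := hsing ⟨1, by omega⟩ (by simp; omega) e2.symm
      exact hg2 _ hd (serSlotXAt r b rB bB q hx (bundlePi r b f q) (hπ q hx)) (by simp [hpi]) e1.symm
    · -- (cD2): red labels
      have e1 := (Prod.mk.inj heq).1
      have := (hg1 _ (inD1_of r b f h2 h3 h1 hr hb)).2
      rw [e1] at h4 this; omega
    · -- (c0): `x` is not a slot-0 image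
      have e1 := (Prod.mk.inj heq).1
      have e2 := (Prod.mk.inj heq).2
      obtain ⟨_, hpi⟩ := hsing ⟨0, by omega⟩ (by simp; omega) e2.symm
      exact h2 ⟨serSlotXAt r b rB bB q hx (bundlePi r b f q) (hπ q hx), by simp [hpi], e1.symm⟩
  · -- ψ avoids the second family
    intro p hr hb hz _ q hz' hr' hb' heq
    rw [bkAssign_serSlotY] at heq
    have hi := q.2
    try simp only [serB, bB] at hi
    have cK : (univ.erase (⟨q.1.2.val, (bkIdx (serSlotY r b rB bB q hz')).2⟩ : Fin K)).card = K - 1 := by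
      rw [card_erase_of_mem (mem_univ _)]; simp
    unfold bundlePsi at heq
    split_ifs at heq with h1 h2 h3 h4
    · -- (c2): the slot index would be `2`, but `b x'' = 2`
      have e1 := (Prod.mk.inj heq).1
      have e2 := (Prod.mk.inj heq).2
      have hi2 : (⟨2, by omega⟩ : Fin K) = ⟨q.1.2.val, (bkIdx (serSlotY r b rB bB q hz')).2⟩ :=
        erase_injOn univ (mem_univ _) (mem_univ _) e2
      have hv : (2 : ℕ) = q.1.2.val := congrArg Fin.val hi2
      have := (hθs _ hr' hb').2.2
      rw [← e1] at this
      omega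
    · have e2 := (Prod.mk.inj heq).2
      have := congrArg Finset.card e2; rw [cK, card_empty] at this; omega
    · have e2 := (Prod.mk.inj heq).2
      have := congrArg Finset.card e2; rw [cK, card_singleton] at this; omega
    · have e1 := (Prod.mk.inj heq).1
      exact hg3 _ (inD1_of r b f h2 h3 h1 hr hb) _ hr' hb' e1.symm
    · have e2 := (Prod.mk.inj heq).2
      have := congrArg Finset.card e2; rw [cK, card_singleton] at this; omega

end Summit.Ventures.PercRepro2.UHClosure
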